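import Mathlib
import Summits.Ventures.PercRepro2.Defs
import Summits.Ventures.PercRepro2.Graph
import Summits.Ventures.PercRepro2.OneColourSwitch
import Summits.Ventures.PercRepro2.RegionHubSign
import Summits.Ventures.PercRepro2.SideSwitch
import Summits.Ventures.PercRepro2.TermSwitchDefs
import Summits.Ventures.PercRepro2.TermSwitchReach
import Summits.Ventures.PercRepro2.M9NoPocketDefs
import Summits.Ventures.PercRepro2.M9Unreached
import Summits.Ventures.PercRepro2.M9GeneralDSplit
import Summits.Ventures.PercRepro2.M9FourParts
import Summits.Ventures.PercRepro2.M9LinkedHD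
import Summits.Ventures.PercRepro2.M9ReachedK
import Summits.Ventures.PercRepro2.M9PsiOneDefs
import Summits.Ventures.PercRepro2.M9PsiOneWorlds
import Summits.Ventures.PercRepro2.M9PsiOneWorldsM
import Summits.Ventures.PercRepro2.M9PsiOneSurvive
import Summits.Ventures.PercRepro2.M9PsiOneLink
import Summits.Ventures.PercRepro2.M9PsiOneLinkW
import Summits.Ventures.PercRepro2.M9PsiOneSigma
import Summits.Ventures.PercRepro2.M9PsiOneInj
import Summits.Ventures.PercRepro2.M9PsiOneSum
import Summits.Ventures.PercRepro2.M9PsiTwoDefs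
import Summits.Ventures.PercRepro2.M9PsiTwoWorlds
import Summits.Ventures.PercRepro2.M9PsiTwoNoLink
import Summits.Ventures.PercRepro2.M9PsiTwoLink
import Summits.Ventures.PercRepro2.M9PsiTwoSigma
import Summits.Ventures.PercRepro2.M9PsiTwoDirty
import Summits.Ventures.PercRepro2.M9PsiTwoUnrooted
import Summits.Ventures.PercRepro2.M9PsiTwoRooted
import Summits.Ventures.PercRepro2.M9PsiTwoRootedY
import Summits.Ventures.PercRepro2.M9PsiTwoRootedPure

/-!
# `Ψ₂` is injective, the summed second payment, and the two injections together (blind cell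
PercRepro2, p3 g34, 2026-08-29; `proofs/P3-REST2.md` §1, claim (iv) and its sum)

The flipped edge set of a source `ω` (`σ_rs = −1`) is recovered from its image: the edges not
at `d` touching `RsetP (Ψ₂ ω) ∪ Uset (Ψ₂ ω)` (= the flipped vertices), and the OPEN edges of
the image from `d` into `RsetP (Ψ₂ ω)` (= the `d`-edges flipped in the pure case)
(`recEdgesP_psiTwo`); so `recPsiP (Ψ₂ ω) = ω` (`recPsiP_psiTwo`) and **`Ψ₂` is injective on
`exMinusSet`** = the doubly-reached colourings with `σ_rs = −1` (`psiTwo_injOn_exMinus`).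
With the pointwise payment (`M9PsiTwoDirty`):
  `Σ_{exMinusSet} σ_pq σ_rs + Σ_{Ψ₂(exMinusSet)} σ_pq σ_rs ≤ 0`   (`exMinus_add_image_nonpos`),
and together with THEOREM Ψ₁ (`M9PsiOneSum`): **the doubly-reached sum is paid twice**,
  `exSum + Σ_{Ψ₁(exPlusSet)} σ_pq σ_rs + Σ_{Ψ₂(exMinusSet)} σ_pq σ_rs ≤ 0`
(`exSum_add_images_nonpos`) — both halves of `EX = 2·EX⁺` by explicit injections into the dirty
one-sided `K`-points.  Own work; std axioms.
-/

namespace Summit.Ventures.PercRepro2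

namespace NoPocket

open Finset Classical RegionHub OneColourSwitch SideSwitch TermSwitch

variable {V : Type*} {E : Type*}

section Rec

variable (ends : E → Sym2 V) (r s d : V) (ω' : Config E)

/-- The edges recovered as flipped from an image: the edges not at `d` touching the full
reconstruction set and the unrooted set, and the open edges from `d` into the reconstruction
set. -/
def recEdgesP : Set E :=
  {e | e ∈ touches ends (RsetP ends r s d ω' ∪ Uset ends r s d ω') ∧ d ∉ ends e} ∪
    {e | ∃ y ∈ RsetP ends r s d ω', ends e = s(d, y) ∧ ω' e = true}

/-- The candidate source of an image: flip the recovered edges back. -/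
noncomputable def recPsiP : Config E :=
  fun e => if e ∈ recEdgesP ends r s d ω' then !ω' e else ω' e

end Rec

section Inj

variable {ends : E → Sym2 V} {p q r s d : V} {ω : Config E}

variable (h : IsEX ends p q r s d ω)
include h

/-- **The recovered edges of `Ψ₂ ω` are the flipped edges of `ω`** (no edge `r–s`, `r ≁_Y s`,
`r ~_W s`). -/
theorem recEdgesP_psiTwo (hrs : ∀ e, ends e ≠ s(r, s)) (hY : ¬ Conn ends ω r s)
    (hc : Conn ends (OneColourSwitch.compl ω) r s) :
    recEdgesP ends r s d (psiTwo ends r s d ω) = flippedW ends r s d ω := by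
  have hset : RsetP ends r s d (psiTwo ends r s d ω) ∪ Uset ends r s d (psiTwo ends r s d ω) =
      flipSetW ends r s d ω := by
    rw [RsetP_psiTwo_eq h hrs hY hc, Uset_psiTwo_eq h hrs]
    ext z
    constructor
    · rintro (hz | hz) <;> exact hz.1
    · intro hz
      by_cases hd : directW ends r s d ω z
      · exact Or.inl ⟨hz, hd⟩
      · exact Or.inr ⟨hz, hd⟩
  ext e
  constructor
  · rintro (⟨he, hd⟩ | ⟨y, hy, hends, he⟩)
    · rw [hset] at he
      exact Or.inl ⟨he, hd⟩
    · -- an open edge of the image from `d` into a direct flipped vertex: it was closed in `ω`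
      -- (`F2′`), so it is a flipped edge
      rw [RsetP_psiTwo_eq h hrs hY hc] at hy
      by_contra hne
      rw [psiTwo_of_not_flipped hne, edge_Mcore_d h (flipSetW_subset_Mcore hy.1)
        (ends_swap hends)] at he
      exact Bool.false_ne_true he
  · rintro (⟨he, hd⟩ | ⟨hp, y, hy, hends, hr⟩)
    · left
      refine ⟨?_, hd⟩
      rw [hset]
      exact he
    · right
      refine ⟨y, ?_, hends, psiTwo_d_opp_eq_true h hp hy hends hr⟩
      rw [RsetP_psiTwo_eq h hrs hY hc]
      refine ⟨Or.inl hy, ?_⟩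
      unfold oppRoot at hr
      split_ifs at hr with hdr
      · exact Or.inr hr
      · exact Or.inl hr

/-- **The source is recovered from the image** (no edge `r–s`, `r ≁_Y s`, `r ~_W s`). -/
theorem recPsiP_psiTwo (hrs : ∀ e, ends e ≠ s(r, s)) (hY : ¬ Conn ends ω r s)
    (hc : Conn ends (OneColourSwitch.compl ω) r s) :
    recPsiP ends r s d (psiTwo ends r s d ω) = ω := by
  funext e
  unfold recPsiP
  rw [recEdgesP_psiTwo h hrs hY hc]
  by_cases he : e ∈ flippedW ends r s d ω
  · rw [if_pos he, psiTwo_of_flipped he, Bool.not_not]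
  · rw [if_neg he, psiTwo_of_not_flipped he]

end Inj

section Sum

variable [Fintype E] [DecidableEq E] {ends : E → Sym2 V} {p q r s d : V}

/-- The doubly-reached colourings with `σ_rs = −1`: `IsEX`, `r ≁_Y s`, `r ~_W s`. -/
noncomputable def exMinusSet (ends : E → Sym2 V) (p q r s d : V) : Finset (Config E) :=
  univ.filter (fun ω => IsEX ends p q r s d ω ∧ ¬ Conn ends ω r s ∧
    Conn ends (OneColourSwitch.compl ω) r s)

/-- Membership in `exMinusSet`. -/
lemma mem_exMinusSet {ω : Config E} :
    ω ∈ exMinusSet ends p q r s d ↔ IsEX ends p q r s d ω ∧ ¬ Conn ends ω r s ∧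
      Conn ends (OneColourSwitch.compl ω) r s := by
  simp [exMinusSet]

/-- **`Ψ₂` is injective on `exMinusSet`** (no edge `r–s`). -/
theorem psiTwo_injOn_exMinus (hrs : ∀ e, ends e ≠ s(r, s)) :
    Set.InjOn (psiTwo ends r s d) ↑(exMinusSet ends p q r s d) := by
  intro ω₁ hω₁ ω₂ hω₂ heq
  obtain ⟨h₁, hY₁, hc₁⟩ := mem_exMinusSet.1 (Finset.mem_coe.1 hω₁)
  obtain ⟨h₂, hY₂, hc₂⟩ := mem_exMinusSet.1 (Finset.mem_coe.1 hω₂)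
  rw [← recPsiP_psiTwo h₁ hrs hY₁ hc₁, ← recPsiP_psiTwo h₂ hrs hY₂ hc₂, heq]

/-- **The image of `Ψ₂` consists of dirty one-sided `K`-points** (no edge `r–s`). -/
theorem psiTwo_mem_HDK_of_mem_exMinus (hrs : ∀ e, ends e ≠ s(r, s)) {ω : Config E}
    (hω : ω ∈ exMinusSet ends p q r s d) :
    HD ends p q r s d (psiTwo ends r s d ω) ∧ d ∈ K2 ends r s (psiTwo ends r s d ω) ∧
      d ∉ M2 ends r s (psiTwo ends r s d ω) := by
  obtain ⟨h, _, hc⟩ := mem_exMinusSet.1 hω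
  exact psiTwo_mem_HDK h hrs hc

/-- **THEOREM Ψ₂, summed**: `Σ_{exMinusSet} σ_pq σ_rs + Σ_{Ψ₂(exMinusSet)} σ_pq σ_rs ≤ 0`
(no edge `r–s`). -/
theorem exMinus_add_image_nonpos (hrs : ∀ e, ends e ≠ s(r, s)) :
    (∑ ω ∈ exMinusSet ends p q r s d, sigma ends ω p q * sigma ends ω r s) +
      ∑ ω ∈ (exMinusSet ends p q r s d).image (psiTwo ends r s d),
        sigma ends ω p q * sigma ends ω r s ≤ 0 := by
  rw [Finset.sum_image (psiTwo_injOn_exMinus hrs), ← Finset.sum_add_distrib]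
  refine Finset.sum_nonpos (fun ω hω => ?_)
  obtain ⟨h, hY, hc⟩ := mem_exMinusSet.1 hω
  exact psiTwo_term_nonpos h hrs hY hc

/-- The `σ_rs = −1` part of the doubly-reached sum is `Σ_{exMinusSet} σ_pq σ_rs`. -/
lemma exMinus_sum_eq' :
    (∑ ω : Config E, if IsEX ends p q r s d ω ∧ ¬ Conn ends ω r s ∧
        Conn ends (OneColourSwitch.compl ω) r s then sigma ends ω p q * sigma ends ω r s else 0) =
      ∑ ω ∈ exMinusSet ends p q r s d, sigma ends ω p q * sigma ends ω r s := by
  rw [exMinusSet, Finset.sum_filter]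

/-- **`exSum = Σ_{exPlusSet} σ_pq + Σ_{exMinusSet} σ_pq σ_rs`** (no edge at `d` to `r, s`). -/
theorem exSum_eq_exPlus_add_exMinus (hT : ∀ e, ends e ≠ s(d, r) ∧ ends e ≠ s(d, s))
    (hr : d ≠ r) (hs : d ≠ s) (hrs : r ≠ s) :
    exSum ends p q r s d = (∑ ω ∈ exPlusSet ends p q r s d, sigma ends ω p q) +
      ∑ ω ∈ exMinusSet ends p q r s d, sigma ends ω p q * sigma ends ω r s := by
  unfold exSum
  rw [Finset.sum_congr rfl (fun ω _ => ex_term_split hT hr hs hrs ω), Finset.sum_add_distrib,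
    exPlus_sum_eq, exMinus_sum_eq']

/-- **THE TWO INJECTIONS TOGETHER**: the doubly-reached sum is paid by `Ψ₁` on the `σ_rs = +1`
half and by `Ψ₂` on the `σ_rs = −1` half,
`exSum + Σ_{Ψ₁(exPlusSet)} σ_pq σ_rs + Σ_{Ψ₂(exMinusSet)} σ_pq σ_rs ≤ 0`
(no edge at `d` to `r, s`, no edge `r–s`). -/
theorem exSum_add_images_nonpos (hT : ∀ e, ends e ≠ s(d, r) ∧ ends e ≠ s(d, s))
    (hr : d ≠ r) (hs : d ≠ s) (hrs : r ≠ s) (hrs' : ∀ e, ends e ≠ s(r, s)) :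
    exSum ends p q r s d +
      (∑ ω ∈ (exPlusSet ends p q r s d).image (psiOne ends r s d),
        sigma ends ω p q * sigma ends ω r s) +
      ∑ ω ∈ (exMinusSet ends p q r s d).image (psiTwo ends r s d),
        sigma ends ω p q * sigma ends ω r s ≤ 0 := by
  rw [exSum_eq_exPlus_add_exMinus hT hr hs hrs]
  have h1 := exPlus_add_image_nonpos (p := p) (q := q) (d := d) hrs'
  have h2 := exMinus_add_image_nonpos (p := p) (q := q) (d := d) hrs'
  linarith

end Sum

end NoPocket

end Summit.Ventures.PercRepro2
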